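import Mathlib
import Summits.KontsevichZagierPeriods.Zeta5Search.ClassFunctionPFIdentity
import HarnessLib

/-!
# ζ(5) search — gen-2 g9's RESIDUE IDENTITIES for the class function are a THEOREM (`RhoResidueIdentities`)

Cell `pub-zeta5` (HONEST FRAMING: systematic search; no irrationality claim unless certified), typer seat
generation 9.  Discharges BY NAME `RhoResidueIdentities` (`Zeta5Search/UniversalDigit.lean` §2; REPORT-gen2-g9 §1; exact checks there
27,619 / 25,875 / 25,875 classes) — the three moment identities of the `ρ_{q,σ}`:
`Σ_q ρ_{q,1} = 0` (`E_x ≤ −2`), `Σ_q (ρ_{q,2} + ℓ_q ρ_{q,1}) = 0` and `Σ_q (ρ_{q,3} + 2ℓ_q ρ_{q,2} + ℓ_q² ρ_{q,1}) = [E_x = −3]` (`E_x ≤ −3`)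
— as the cases `k = 0, 1, 2` of the residue theorem `classResidueSum` for `η^k Φ_x` (`ClassFunctionPFIdentity.lean`), after
identifying `ρ^{(k)}_{q,1} = [ε^{n_q−1}] (ε + ℓ_q)^k G_q(ε)` with the stated combinations of `ρ_{q,1}, ρ_{q,2}, ρ_{q,3}`.
These identities are the algebraic core of the `𝒦`-digit (U-K) and of the reversal identity (R).  Pure algebra; nothing about irrationality.
-/

noncomputable section

open Finset

namespace Summit.KontsevichZagierPeriods.Zeta5Search.ClusterValuation

open Summit.KontsevichZagierPeriods.Zeta5Search.DualSeries (InBox)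
open Summit.KontsevichZagierPeriods.Zeta5Search.CasoratianValuation (InPolytope)

/-! ### `ρ^{(k)}_{q,1}` for `k = 0, 1, 2` -/

/-- `ρ^{(0)}_{q,1} = ρ_{q,1}`. -/
theorem rhoK_zero_one (b : ℕ → ℤ) (p q : ℕ) : rhoK b p q 0 1 = classRho b p q 1 := by
  unfold rhoK classRho
  rw [pow_zero, one_mul]

/-- `ρ^{(1)}_{q,1} = ρ_{q,2} + ℓ_q ρ_{q,1}` (the first term only for a pole of order `≥ 2`). -/
theorem rhoK_one_one (b : ℕ → ℤ) (p q : ℕ) (hq : netExp b q < 0) :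
    rhoK b p q 1 1 = (if netExp b q ≤ -2 then classRho b p q 2 else 0) + lvl p q * classRho b p q 1 := by
  unfold rhoK classRho
  rw [pow_one, add_mul, map_add, PowerSeries.coeff_C_mul, ← pow_one (PowerSeries.X : PowerSeries ℚ),
    PowerSeries.coeff_X_pow_mul']
  by_cases h2 : netExp b q ≤ -2
  · rw [if_pos (by omega), if_pos h2, show (-netExp b q).toNat - 1 - 1 = (-netExp b q).toNat - 2 by omega]
  · rw [if_neg (by omega), if_neg h2]

/-- `ρ^{(2)}_{q,1} = ρ_{q,3} + 2ℓ_q ρ_{q,2} + ℓ_q² ρ_{q,1}` (terms present according to the pole order). -/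
theorem rhoK_two_one (b : ℕ → ℤ) (p q : ℕ) (hq : netExp b q < 0) :
    rhoK b p q 2 1 = (if netExp b q ≤ -3 then classRho b p q 3 else 0)
      + 2 * lvl p q * (if netExp b q ≤ -2 then classRho b p q 2 else 0) + (lvl p q) ^ 2 * classRho b p q 1 := by
  unfold rhoK classRho
  have e : (PowerSeries.X + PowerSeries.C (lvl p q)) ^ 2 * classCofactor b p q =
      PowerSeries.X ^ 2 * classCofactor b p q + PowerSeries.C (2 * lvl p q) * (PowerSeries.X ^ 1 * classCofactor b p q) +
        PowerSeries.C ((lvl p q) ^ 2) * classCofactor b p q := by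
    rw [map_mul, map_pow, show (PowerSeries.C (2 : ℚ) : PowerSeries ℚ) = 2 from map_ofNat PowerSeries.C 2]
    ring
  rw [e, map_add, map_add, PowerSeries.coeff_C_mul, PowerSeries.coeff_C_mul, PowerSeries.coeff_X_pow_mul',
    PowerSeries.coeff_X_pow_mul']
  by_cases h3 : netExp b q ≤ -3
  · rw [if_pos (by omega), if_pos h3, if_pos (by omega), if_pos (by omega),
      show (-netExp b q).toNat - 1 - 2 = (-netExp b q).toNat - 3 by omega,
      show (-netExp b q).toNat - 1 - 1 = (-netExp b q).toNat - 2 by omega]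
  · rw [if_neg (by omega), if_neg h3]
    by_cases h2 : netExp b q ≤ -2
    · rw [if_pos (by omega), if_pos h2, show (-netExp b q).toNat - 1 - 1 = (-netExp b q).toNat - 2 by omega]
    · rw [if_neg (by omega), if_neg h2]

/-! ### The residue identities -/

/-- **`RhoResidueIdentities` is a theorem.** -/
theorem rhoResidueIdentities_holds : RhoResidueIdentities := by
  intro b p x _hb hprime _hp5 _hwin _hx
  have hp0 : 0 < p := hprime.pos
  have hE := classExp_eq_degN_sub_degD b p x
  refine ⟨fun h2 => ?_, fun h3 => ?_, fun h3 => ?_⟩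
  · have hres := classResidueSum b (x := x) hp0 0 (by omega)
    rw [if_neg (by omega)] at hres
    rw [← hres]
    exact sum_congr rfl fun q _ => (rhoK_zero_one b p q).symm
  · have hres := classResidueSum b (x := x) hp0 1 (by omega)
    rw [if_neg (by omega)] at hres
    refine Eq.trans (sum_congr rfl fun q hq => ?_) hres
    rw [rhoK_one_one b p q (mem_filter.1 hq).2]
    rfl
  · have hres := classResidueSum b (x := x) hp0 2 (by omega)
    have hiff : (degN b p x + 2 + 1 = degD b p x) ↔ (classExp b p x = -3) := by omega
    rw [show (if degN b p x + 2 + 1 = degD b p x then (1 : ℚ) else 0) = (if classExp b p x = -3 then (1 : ℚ) else 0) by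
      simp only [hiff]] at hres
    refine Eq.trans (sum_congr rfl fun q hq => ?_) hres
    rw [rhoK_two_one b p q (mem_filter.1 hq).2]
    rfl

end Summit.KontsevichZagierPeriods.Zeta5Search.ClusterValuation

end
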